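import Summits.QuantumFields.YangMills.Theorems.SwapVirialDeficitSectorLaplaceEndGaussN2Far
import Summits.QuantumFields.YangMills.Theorems.SwapVirialDeficitBlowUpGnomonicFollowerIntegralLetters
import HarnessLib

/-!
# N2a (steps (i)–(iii)) — THE NEAR CASE of the pointwise fibre bound for `stub_end_gaussCore`, RAW FORM in leader letters: T1 at full `b` + the three-letter split
# (skeleton ➎; LEAD sfw-p2 g99 rulings 2026-08-31 23:12Z (N2 = N2a ⊔ N2b) and g48's handover 23:20Z; free-hands support of ⟨stmt-QuantumFields-24197⟩
# `SwapVirialDeficit.SwapGluedStiffness`)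

At a T1-ADMISSIBLE leader point `η₀ = ((x, y), (z, 0))` at the hub `hubAt δ 1` (commutators and σ-relations `≤ s_T`, `F̂(η₀) ≤ μρ²/4`) the follower integral of
`bDensity·g` (`g ≤ e^{−bF̂}`) is bounded by w2's ✓`follower_laplace_ceiling` at FULL `b` (via ✓`lintegral_follower_exp_eq_gnoFol`), and the exponent at the follower
minimiser `m = F̂(η₀ + y⋆)` is split `e^{−bm} = e^{−(b/6)m}·e^{−(5b/6)m}` with `e^{−(b/6)m} ≤` the three leader Gaussians (✓`endGauss_exp_three_floor`, `c = b/(6·55200L⁶)`;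
the leaders of `η₀ + gnoFolEmb y⋆` are those of `η₀`, ✓`leaders_add_gnoFolEmb`).  Stated in GENERAL leader letters `x y z : Fin 3 → ℝ` with `gnomonicWeight` factors (the
glue instantiates `x = (t1∷u)`, `y = (t2∷v)` and rewrites `gnomonicWeight (t1∷u) = ((1+t1²+|u|²)²)⁻¹`):
* `bDensity_letters_eq` (`((1+δ²)⁻¹)²·gnoDensity((x,y),(z,F)) = ((1+δ²)⁻¹)²·(gW x·gW y·gW z·piWeight F)`), ★★★ `endGauss_N2_near_raw` (∃ minimiser `ys` with
  `‖ys‖² ≤ F̂(η₀)/μ_F`, `(μ_F/2)`-coercivity at `η₀ + gnoFolEmb ys`, and the bound `J ≤ e^{−(5b/6)m}·(Gauss/√det A(η₀+ys) + tail·∫piWeight)·X·Y·Z`).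
Steps (iv) (det ↦ reference `D`, g48 ✓`sqrt_det_inv_slabHub_le_ref`) and (v) (crude bound off the localisation radius) consume exactly these conjuncts.

HONEST LABEL: composition of landed lemmas; steps (iv)/(v), the glue with ✓`endGauss_N2_far`, the final plug (memo-ε) of `stub_end_gaussCore`, and `stub_core_tip` are OPEN ⟹
⟨24197⟩ ∕ ⟨24194⟩ OPEN; own crux ⟨22884⟩ OPEN (blocked-on ⟨19935⟩); the Yang–Mills mass gap is NOT proved; no summit is proved by a line.  THEOREMS ONLY (0 `def`, 0 `sorry`),
standard axioms.  Width seat ym-line-sfw-p2-w3 g67 (cell ym-idea-1, free hands), `--supports stmt-QuantumFields-24197`.  References: [folklore]; [cite: Luscher1983, §2].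
-/

set_option autoImplicit false
set_option synthInstance.maxSize 1024

noncomputable section

open MeasureTheory Quaternion Set Module
open scoped Quaternion BigOperators ENNReal InnerProductSpace
open Literature.MathematicalPhysics.QuantumLattice
open Literature.MathematicalPhysics.QuantumFieldTheory hiding SU2

namespace Summit.QuantumFields.YangMills.Theorems.SwapVirialDeficit.BlowUpRing

open Summit.QuantumFields.YangMills.Theorems.FemtoTransferGap
open Summit.QuantumFields.YangMills.Theorems.FemtoTransferGap.TT
open Summit.QuantumFields.YangMills.Theorems.VirialFluxGap.RingDeficit
open Summit.QuantumFields.YangMills.Theorems.SwapVirialDeficit.SwapRing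
open Summit.QuantumFields.YangMills.Theorems.SwapVirialDeficit.Gnomonic (normSq3 gnomonicWeight piWeight piWeight_pos piWeight_le_one continuous_piWeight)

variable {L : ℕ} [NeZero L]

/-- The B-density in leader letters: `((1+δ²)⁻¹)²·gnoDensity((x,y),(z,F)) ≤ gW x·gW y·gW z·piWeight F` in `ℝ≥0∞`. [folklore] -/
theorem bDensity_letters_le_piWeight (δ : ℝ) (x y z : Fin 3 → ℝ) (F : Fol L → Fin 3 → ℝ) :
    ENNReal.ofReal (((1 + δ ^ 2)⁻¹) ^ 2 * gnoDensity ((((x, y), (z, F))) : GnoCoord L)) ≤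
      ENNReal.ofReal (gnomonicWeight x) * ENNReal.ofReal (gnomonicWeight y) * ENNReal.ofReal (gnomonicWeight z) * ENNReal.ofReal (piWeight F) := by
  have hx := (Gnomonic.gnomonicWeight_pos x).le
  have hy := (Gnomonic.gnomonicWeight_pos y).le
  have hz := (Gnomonic.gnomonicWeight_pos z).le
  have hp := (piWeight_pos F).le
  rw [← ENNReal.ofReal_mul hx, ← ENNReal.ofReal_mul (mul_nonneg hx hy), ← ENNReal.ofReal_mul (mul_nonneg (mul_nonneg hx hy) hz)]
  refine ENNReal.ofReal_le_ofReal ?_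
  have h1 : ((1 + δ ^ 2)⁻¹) ^ 2 ≤ 1 := by
    have : (1 + δ ^ 2)⁻¹ ≤ 1 := inv_le_one_of_one_le₀ (by nlinarith [sq_nonneg δ])
    have h0 : 0 ≤ (1 + δ ^ 2)⁻¹ := by positivity
    nlinarith
  have e : gnoDensity ((((x, y), (z, F))) : GnoCoord L) = gnomonicWeight x * gnomonicWeight y * gnomonicWeight z * piWeight F := rfl
  rw [e]
  have h0 : 0 ≤ gnomonicWeight x * gnomonicWeight y * gnomonicWeight z * piWeight F := by positivity
  nlinarith

/-- ★★★ **N2a, RAW NEAR CASE** in leader letters `x y z` at the hub `hubAt δ 1` (followers' signs `+`, `δ² ≤ 1/3`, `x₁² + x₂² ≤ 1 + x₀²`, `0 < b`). [cite: Luscher1983, §2] -/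
theorem endGauss_N2_near_raw (ε : GnoSign L) (hε : ε.2.2 = fun _ => true) (δ : ℝ) (x y z : Fin 3 → ℝ)
    (hδ : δ ^ 2 ≤ 1 / 3) (hu : (x 1) ^ 2 + (x 2) ^ 2 ≤ 1 + (x 0) ^ 2) {b : ℝ} (hb : 0 < b)
    (g : ℝ × GnoCoord L → ℝ≥0∞)
    (hg : ∀ F : Fol L → Fin 3 → ℝ, g (δ, (((x, y), (z, F)) : GnoCoord L)) ≤
      ENNReal.ofReal (Real.exp (-(b * gnoDeficit (fun _ => false) (fun _ => 1) (hubAt δ 1) ε (((x, y), (z, F)) : GnoCoord L)))))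
    {A : GnoCoord L → GnoFol L →ₗ[ℝ] GnoFol L} (hAs : ∀ η', (A η').IsSymmetric)
    (hAyy : ∀ η' (w : GnoFol L), ⟪A η' w, w⟫_ℝ = iteratedFDeriv ℝ 2 (fun y' : GnoFol L => gnoDeficit (fun _ => false) (fun _ => 1) (hubAt δ 1) ε (η' + gnoFolEmb y')) 0 (fun _ => w))
    (hray : ∀ η' (w : GnoFol L), ⟪A η' w, w⟫_ℝ = iteratedDeriv 2 (fun s : ℝ => gnoDeficit (fun _ => false) (fun _ => 1) (hubAt δ 1) ε (η' + s • gnoFolEmb w)) 0)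
    {sT : ℝ} (hsT : 0 ≤ sT)
    (hCC : ∀ μ ν : Fin 3, frobNorm ((((blowUpPoint 1 (gnomonicPoint (hubAt δ 1) ε (((x, y), (z, (0 : Fol L → Fin 3 → ℝ))) : GnoCoord L))).1 (Fin.castSucc μ) *
        (blowUpPoint 1 (gnomonicPoint (hubAt δ 1) ε (((x, y), (z, (0 : Fol L → Fin 3 → ℝ))) : GnoCoord L))).1 (Fin.castSucc ν) : SU2) : Matrix (Fin 2) (Fin 2) ℂ) -
        (((blowUpPoint 1 (gnomonicPoint (hubAt δ 1) ε (((x, y), (z, (0 : Fol L → Fin 3 → ℝ))) : GnoCoord L))).1 (Fin.castSucc ν) *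
        (blowUpPoint 1 (gnomonicPoint (hubAt δ 1) ε (((x, y), (z, (0 : Fol L → Fin 3 → ℝ))) : GnoCoord L))).1 (Fin.castSucc μ) : SU2) : Matrix (Fin 2) (Fin 2) ℂ)) ≤ sT)
    (hσ : ∀ μ : Fin 3, frobNorm ((((blowUpPoint 1 (gnomonicPoint (hubAt δ 1) ε (((x, y), (z, (0 : Fol L → Fin 3 → ℝ))) : GnoCoord L))).1 (Fin.last 3) *
        (blowUpPoint 1 (gnomonicPoint (hubAt δ 1) ε (((x, y), (z, (0 : Fol L → Fin 3 → ℝ))) : GnoCoord L))).1 (Fin.castSucc (Equiv.swap (0 : Fin 3) 1 μ)) : SU2) :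
          Matrix (Fin 2) (Fin 2) ℂ) -
        (((blowUpPoint 1 (gnomonicPoint (hubAt δ 1) ε (((x, y), (z, (0 : Fol L → Fin 3 → ℝ))) : GnoCoord L))).1 (Fin.castSucc μ) *
        (blowUpPoint 1 (gnomonicPoint (hubAt δ 1) ε (((x, y), (z, (0 : Fol L → Fin 3 → ℝ))) : GnoCoord L))).1 (Fin.last 3) : SU2) : Matrix (Fin 2) (Fin 2) ℂ)) ≤ sT)
    (hs2 : sT ^ 2 ≤ ((2304 * (L : ℝ) ^ 6 * (Fintype.card (Fol L) : ℝ))⁻¹) ^ 2 / (304992000000 * (L : ℝ) ^ 8))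
    (hflat : gnoDeficit (fun _ => false) (fun _ => 1) (hubAt δ 1) ε (((x, y), (z, (0 : Fol L → Fin 3 → ℝ))) : GnoCoord L) ≤
      (2304 * (L : ℝ) ^ 6 * (Fintype.card (Fol L) : ℝ))⁻¹ * ((2304 * (L : ℝ) ^ 6 * (Fintype.card (Fol L) : ℝ))⁻¹ / (6 * (2484000 * (L : ℝ) ^ 4))) ^ 2 / 4) :
    ∃ ys : GnoFol L,
      ‖ys‖ ^ 2 ≤ gnoDeficit (fun _ => false) (fun _ => 1) (hubAt δ 1) ε (((x, y), (z, (0 : Fol L → Fin 3 → ℝ))) : GnoCoord L) /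
          (2304 * (L : ℝ) ^ 6 * (Fintype.card (Fol L) : ℝ))⁻¹ ∧
      (∀ w : GnoFol L, (2304 * (L : ℝ) ^ 6 * (Fintype.card (Fol L) : ℝ))⁻¹ / 2 * ‖w‖ ^ 2 ≤
        ⟪A ((((x, y), (z, (0 : Fol L → Fin 3 → ℝ))) : GnoCoord L) + gnoFolEmb ys) w, w⟫_ℝ) ∧
      ∫⁻ F : Fol L → Fin 3 → ℝ, ENNReal.ofReal (((1 + δ ^ 2)⁻¹) ^ 2 * gnoDensity ((((x, y), (z, F))) : GnoCoord L)) * g (δ, (((x, y), (z, F)) : GnoCoord L)) ≤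
        ENNReal.ofReal (Real.exp (-(5 * b / 6 * gnoDeficit (fun _ => false) (fun _ => 1) (hubAt δ 1) ε
            ((((x, y), (z, (0 : Fol L → Fin 3 → ℝ))) : GnoCoord L) + gnoFolEmb ys)))) *
          (ENNReal.ofReal ((2 * Real.pi / ((1 - 1 / (2 * (finrank ℝ (GnoFol L) : ℝ))) * b)) ^ ((finrank ℝ (GnoFol L) : ℝ) / 2) /
              Real.sqrt (LinearMap.det (A ((((x, y), (z, (0 : Fol L → Fin 3 → ℝ))) : GnoCoord L) + gnoFolEmb ys)))) +
            ENNReal.ofReal (Real.exp (-(b * ((2304 * (L : ℝ) ^ 6 * (Fintype.card (Fol L) : ℝ))⁻¹ *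
                (3 * ((2304 * (L : ℝ) ^ 6 * (Fintype.card (Fol L) : ℝ))⁻¹ / 2) / (2 * (finrank ℝ (GnoFol L) : ℝ) * (2484000 * (L : ℝ) ^ 4))) ^ 2 / 4))) *
              ∫ w : GnoFol L, piWeight (gnoFolBlocks w))) *
        ENNReal.ofReal (gnomonicWeight x * Real.exp (-(b / (6 * (55200 * (L : ℝ) ^ 6)) *
          (16 * δ ^ 2 / (1 + δ ^ 2) + 8 * (x 0) ^ 2 / ((1 + (x 0) ^ 2) * (1 + δ ^ 2)) + 4 * (y 0) ^ 2 / (1 + (y 0) ^ 2)) *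
          ((x 1) ^ 2 + (x 2) ^ 2) / (1 + (x 0) ^ 2 + ((x 1) ^ 2 + (x 2) ^ 2))))) *
        ENNReal.ofReal (gnomonicWeight y * Real.exp (-(b / (6 * (55200 * (L : ℝ) ^ 6)) * ((y 1) ^ 2 + (y 2) ^ 2) / (1 + (y 0) ^ 2 + ((y 1) ^ 2 + (y 2) ^ 2))))) *
        ENNReal.ofReal (gnomonicWeight z * Real.exp (-(b / (6 * (55200 * (L : ℝ) ^ 6)) * normSq3 z / (1 + normSq3 z)))) := by
  have hc0 : 0 ≤ b / (6 * (55200 * (L : ℝ) ^ 6)) := by positivity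
  have hcb : b / (6 * (55200 * (L : ℝ) ^ 6)) * (55200 * (L : ℝ) ^ 6) = b / 6 := by
    have hL0 : (L : ℝ) ≠ 0 := by exact_mod_cast (NeZero.ne L)
    field_simp
  -- T1 at full `b`
  obtain ⟨ys, hys, -, hcoer, hint⟩ := follower_laplace_ceiling (L := L) (hubAt_one_ne_zero δ) ε hε (((x, y), (z, (0 : Fol L → Fin 3 → ℝ))) : GnoCoord L) rfl
    (A := A) hAs hAyy hray hsT hCC hσ hs2 hflat
  refine ⟨ys, hys, hcoer, ?_⟩
  have hlead : ((((x, y), (z, (0 : Fol L → Fin 3 → ℝ))) : GnoCoord L) + gnoFolEmb ys) = (((x, y), (z, gnoFolBlocks ys)) : GnoCoord L) := leaders_add_gnoFolEmb x y z ys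
  -- the exponential three-letter split at the minimiser
  have h3 := endGauss_exp_three_floor (L := L) δ hδ ε (((x, y), (z, gnoFolBlocks ys)) : GnoCoord L) hu hc0
  rw [hcb] at h3
  -- names
  set m : ℝ := gnoDeficit (fun _ => false) (fun _ => 1) (hubAt δ 1) ε ((((x, y), (z, (0 : Fol L → Fin 3 → ℝ))) : GnoCoord L) + gnoFolEmb ys) with hm
  have hm' : gnoDeficit (fun _ => false) (fun _ => 1) (hubAt δ 1) ε (((x, y), (z, gnoFolBlocks ys)) : GnoCoord L) = m := by rw [hm, hlead]
  rw [hm'] at h3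
  set EX : ℝ := Real.exp (-(b / (6 * (55200 * (L : ℝ) ^ 6)) *
      (16 * δ ^ 2 / (1 + δ ^ 2) + 8 * (x 0) ^ 2 / ((1 + (x 0) ^ 2) * (1 + δ ^ 2)) + 4 * (y 0) ^ 2 / (1 + (y 0) ^ 2)) *
      ((x 1) ^ 2 + (x 2) ^ 2) / (1 + (x 0) ^ 2 + ((x 1) ^ 2 + (x 2) ^ 2)))) with hEX
  set EY : ℝ := Real.exp (-(b / (6 * (55200 * (L : ℝ) ^ 6)) * ((y 1) ^ 2 + (y 2) ^ 2) / (1 + (y 0) ^ 2 + ((y 1) ^ 2 + (y 2) ^ 2)))) with hEY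
  set EZ : ℝ := Real.exp (-(b / (6 * (55200 * (L : ℝ) ^ 6)) * normSq3 z / (1 + normSq3 z))) with hEZ
  have h3' : Real.exp (-(b / 6 * m)) ≤ EX * EY * EZ := h3
  have hEX0 : 0 < EX := by rw [hEX]; exact Real.exp_pos _
  have hEY0 : 0 < EY := by rw [hEY]; exact Real.exp_pos _
  have hEZ0 : 0 < EZ := by rw [hEZ]; exact Real.exp_pos _
  set Gs : ℝ := (2 * Real.pi / ((1 - 1 / (2 * (finrank ℝ (GnoFol L) : ℝ))) * b)) ^ ((finrank ℝ (GnoFol L) : ℝ) / 2) /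
      Real.sqrt (LinearMap.det (A ((((x, y), (z, (0 : Fol L → Fin 3 → ℝ))) : GnoCoord L) + gnoFolEmb ys))) with hGs
  set Tl : ℝ := Real.exp (-(b * ((2304 * (L : ℝ) ^ 6 * (Fintype.card (Fol L) : ℝ))⁻¹ *
      (3 * ((2304 * (L : ℝ) ^ 6 * (Fintype.card (Fol L) : ℝ))⁻¹ / 2) / (2 * (finrank ℝ (GnoFol L) : ℝ) * (2484000 * (L : ℝ) ^ 4))) ^ 2 / 4))) *
      ∫ w : GnoFol L, piWeight (gnoFolBlocks w) with hTl
  have hpiW := folWeight_facts (L := L)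
  have hPi0 : 0 ≤ ∫ w : GnoFol L, piWeight (gnoFolBlocks w) := integral_nonneg fun w => (hpiW.2.1 w).le
  have hTl0 : 0 ≤ Tl := by rw [hTl]; exact mul_nonneg (Real.exp_pos _).le hPi0
  have hGs0 : 0 ≤ Gs := by
    rw [hGs]
    refine div_nonneg (Real.rpow_nonneg (div_nonneg (by positivity) (mul_nonneg ?_ hb.le)) _) (Real.sqrt_nonneg _)
    have h9 := nine_le_finrank_gnoFol (L := L)
    have h18 : (18 : ℝ) ≤ 2 * (finrank ℝ (GnoFol L) : ℝ) := by linarith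
    have : 1 / (2 * (finrank ℝ (GnoFol L) : ℝ)) ≤ 1 / 18 := div_le_div_of_nonneg_left (by norm_num) (by norm_num) h18
    linarith
  -- T1's bound as `e^{-bm}·(Gs + Tl)`
  have hT1 : ∫ w : GnoFol L, Real.exp (-(b * gnoDeficit (fun _ => false) (fun _ => 1) (hubAt δ 1) ε
      ((((x, y), (z, (0 : Fol L → Fin 3 → ℝ))) : GnoCoord L) + gnoFolEmb w))) * piWeight (gnoFolBlocks w) ≤ Real.exp (-(b * m)) * (Gs + Tl) := by
    have e : Real.exp (-(b * m)) * (Gs + Tl) = Real.exp (-(b * m)) * Gs +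
        Real.exp (-(b * (m + (2304 * (L : ℝ) ^ 6 * (Fintype.card (Fol L) : ℝ))⁻¹ *
          (3 * ((2304 * (L : ℝ) ^ 6 * (Fintype.card (Fol L) : ℝ))⁻¹ / 2) / (2 * (finrank ℝ (GnoFol L) : ℝ) * (2484000 * (L : ℝ) ^ 4))) ^ 2 / 4))) *
          ∫ w : GnoFol L, piWeight (gnoFolBlocks w) := by
      rw [hTl, mul_add, ← mul_assoc, ← Real.exp_add]; congr 2; ring
    rw [e, hGs]
    simpa only [div_eq_mul_inv] using hint b hb
  -- pointwise in `F`, then the fibre integral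
  have hmeasD : Measurable fun F : Fol L → Fin 3 → ℝ => gnoDeficit (fun _ => false) (fun _ => 1) (hubAt δ 1) ε (((x, y), (z, F)) : GnoCoord L) :=
    (measurable_gnoDeficit (fun _ => false) (fun _ => 1) (hubAt δ 1) ε).comp (by fun_prop)
  have hmeasI : Measurable fun F : Fol L → Fin 3 → ℝ => ENNReal.ofReal (piWeight F * Real.exp (-(b * gnoDeficit (fun _ => false) (fun _ => 1) (hubAt δ 1) ε (((x, y), (z, F)) : GnoCoord L)))) :=
    Measurable.ennreal_ofReal (continuous_piWeight.measurable.mul (Real.measurable_exp.comp ((hmeasD.const_mul b).neg)))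
  have hJ : ∫⁻ F : Fol L → Fin 3 → ℝ, ENNReal.ofReal (((1 + δ ^ 2)⁻¹) ^ 2 * gnoDensity ((((x, y), (z, F))) : GnoCoord L)) * g (δ, (((x, y), (z, F)) : GnoCoord L)) ≤
      (ENNReal.ofReal (gnomonicWeight x) * ENNReal.ofReal (gnomonicWeight y) * ENNReal.ofReal (gnomonicWeight z)) *
        ∫⁻ F : Fol L → Fin 3 → ℝ, ENNReal.ofReal (piWeight F * Real.exp (-(b * gnoDeficit (fun _ => false) (fun _ => 1) (hubAt δ 1) ε (((x, y), (z, F)) : GnoCoord L)))) := by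
    rw [← lintegral_const_mul _ hmeasI]
    refine lintegral_mono fun F => ?_
    calc ENNReal.ofReal (((1 + δ ^ 2)⁻¹) ^ 2 * gnoDensity ((((x, y), (z, F))) : GnoCoord L)) * g (δ, (((x, y), (z, F)) : GnoCoord L))
        ≤ (ENNReal.ofReal (gnomonicWeight x) * ENNReal.ofReal (gnomonicWeight y) * ENNReal.ofReal (gnomonicWeight z) * ENNReal.ofReal (piWeight F)) *
            ENNReal.ofReal (Real.exp (-(b * gnoDeficit (fun _ => false) (fun _ => 1) (hubAt δ 1) ε (((x, y), (z, F)) : GnoCoord L)))) :=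
          mul_le_mul' (bDensity_letters_le_piWeight δ x y z F) (hg F)
      _ = _ := by rw [mul_assoc, ← ENNReal.ofReal_mul (piWeight_pos F).le]
  have hfib : ∫⁻ F : Fol L → Fin 3 → ℝ, ENNReal.ofReal (piWeight F * Real.exp (-(b * gnoDeficit (fun _ => false) (fun _ => 1) (hubAt δ 1) ε (((x, y), (z, F)) : GnoCoord L)))) ≤
      ENNReal.ofReal (Real.exp (-(b * m)) * (Gs + Tl)) := by
    rw [lintegral_follower_exp_eq_gnoFol (fun _ => false) (fun _ => 1) (hubAt δ 1) ε x y z hb.le]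
    exact ENNReal.ofReal_le_ofReal hT1
  -- split `e^{-bm} = e^{-(5b/6)m}·e^{-(b/6)m}` and insert the three factors
  have hsplit : Real.exp (-(b * m)) * (Gs + Tl) ≤ (Real.exp (-(5 * b / 6 * m)) * (Gs + Tl)) * (EX * EY * EZ) := by
    have e : Real.exp (-(b * m)) = Real.exp (-(5 * b / 6 * m)) * Real.exp (-(b / 6 * m)) := by rw [← Real.exp_add]; congr 1; ring
    rw [e]
    calc Real.exp (-(5 * b / 6 * m)) * Real.exp (-(b / 6 * m)) * (Gs + Tl) = (Real.exp (-(5 * b / 6 * m)) * (Gs + Tl)) * Real.exp (-(b / 6 * m)) := by ring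
      _ ≤ (Real.exp (-(5 * b / 6 * m)) * (Gs + Tl)) * (EX * EY * EZ) :=
          mul_le_mul_of_nonneg_left h3' (mul_nonneg (Real.exp_pos _).le (add_nonneg hGs0 hTl0))
  clear_value m EX EY EZ Gs Tl
  have hwx := (Gnomonic.gnomonicWeight_pos x).le
  have hwy := (Gnomonic.gnomonicWeight_pos y).le
  have hwz := (Gnomonic.gnomonicWeight_pos z).le
  calc ∫⁻ F : Fol L → Fin 3 → ℝ, ENNReal.ofReal (((1 + δ ^ 2)⁻¹) ^ 2 * gnoDensity ((((x, y), (z, F))) : GnoCoord L)) * g (δ, (((x, y), (z, F)) : GnoCoord L))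
      ≤ (ENNReal.ofReal (gnomonicWeight x) * ENNReal.ofReal (gnomonicWeight y) * ENNReal.ofReal (gnomonicWeight z)) * ENNReal.ofReal (Real.exp (-(b * m)) * (Gs + Tl)) :=
        hJ.trans (mul_le_mul_right hfib _)
    _ ≤ (ENNReal.ofReal (gnomonicWeight x) * ENNReal.ofReal (gnomonicWeight y) * ENNReal.ofReal (gnomonicWeight z)) *
          ENNReal.ofReal ((Real.exp (-(5 * b / 6 * m)) * (Gs + Tl)) * (EX * EY * EZ)) := mul_le_mul_right (ENNReal.ofReal_le_ofReal hsplit) _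
    _ = ENNReal.ofReal (Real.exp (-(5 * b / 6 * m))) * (ENNReal.ofReal Gs + ENNReal.ofReal Tl) *
          ENNReal.ofReal (gnomonicWeight x * EX) * ENNReal.ofReal (gnomonicWeight y * EY) * ENNReal.ofReal (gnomonicWeight z * EZ) := by
        rw [← ENNReal.ofReal_add hGs0 hTl0, ← ENNReal.ofReal_mul hwx, ← ENNReal.ofReal_mul (mul_nonneg hwx hwy), ← ENNReal.ofReal_mul (by positivity),
          ofReal_mul5 (Real.exp_pos _).le (add_nonneg hGs0 hTl0) (mul_nonneg hwx hEX0.le) (mul_nonneg hwy hEY0.le)]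
        congr 1; ring

end Summit.QuantumFields.YangMills.Theorems.SwapVirialDeficit.BlowUpRing

end
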